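import Summits.QuantumFields.BalabanUV.T4Continuum.Support.ShellMeasureLandauPinnedField
import Summits.QuantumFields.BalabanUV.T4Continuum.Support.ShellMeasureLandauCfPinned

/-!
# `T4Continuum.ShellMeasureLandauPinnedLipschitz` — row S70 companion f2, file 3: THE PINNED CHAIN BINDERS `hCp` ∕ `hGWp`
# OF `ShellMeasureLandauPinnedField` INHABITED BY LOCALITY (no derivative, no decay display for `Cf`)
(cell `pub-balaban`, sub-cell `t4`, spine estimate NE7c (node U5b); NE7c ROUND-2 crew, unit
`b2b-balaban-t4-ne7c-formalise-leaf-07` gen 7 — own-initiative companion of row S70 «END-II-loc: THE LD CHAIN IN TWO NORMS»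
of `t4/b2b-balaban-t4-ne7c-p1/LEAVES-NE7c-P1.md` (journal OFFER l.17504); ADDITIVE — imports this lineage's
`ShellMeasureLandauPinnedField` (p225019: `norm_sub_landauField_chart_le`) and leaf-08's CfP `ShellMeasureLandauCfPinned`
(p226424: hence S69 `ShellMeasurePinnedNorm`, S64 `ShellMeasureLandauCorrectionB7`, S68 (b) `ShellMeasureAverageLocality148`)
ONLY; [folklore]; 0 `def`, 0 `def … : Prop`, 0 sorry, 0 citation)

HONEST FRAMING.  Finite four-torus programme, rung (B)+1 only — NOT infinite volume, NOT a mass gap, NOT the Clay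
problem, NOT summit progress; (B), `BetaPertHyp`, (B^μ) not consumed.  NE7c (`T4IndicatorShell.ShellWeightBound`) is
NOT PRINTED in [Balaban 1983–89] and NOT PROVED; «NE7c ⇐ the named binders» (trigger c3).  Nothing printed is asserted
here; no estimate of Bałaban's is discharged.  PLUMBING on OUR side: one Lipschitz pin lemma, one Cauchy estimate, two
compositions, one junction.

THE POINT.  The pinned Wilson supplier of END-II (row S74 f2 `ShellMeasureLandauWilsonSquaresPinned.hE_landau_wilsonSquares_pinned`,
the far plaquettes) carries this lineage's PINNED CHAIN BINDERS of `ShellMeasureLandauPinnedField.norm_sub_landauField_chart_le`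
verbatim.  Four of them read LINEAR letters (`hιp`, `hHp`, `hH₁p`, the `𝒢`-half of `hGWp`): pinned OPERATOR bounds, the
output shape of S69 (A) `ShellMeasurePinnedNorm.opNorm_kerOpPin_le` ((46)∕(103)∕(3.133) decay-halves TYPE, one call each at
the dictionary); `hΦp` is S75 `ShellMeasurePinnedProp4.norm_ofPin_le_of_support`.  The two NONLINEAR ones are
* `hCp : ‖π𝒳 (C A) − π𝒳 (C A′)‖ ≤ L_C·‖π𝒴′ A − π𝒴′ A′‖` on the FLAT ball (the (44) letter, pinned-Lipschitz), and
* the `W`-half of `hGWp` (the (P4) letter, pinned-Lipschitz on the flat ball).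
So far the tree inhabits them only through DERIVATIVES (leaf-08 `ShellMeasureLandauDerivativeDecayPinned.norm_sub_pin_le_of_entry_decay`
from a DISPLAYED (73)-TYPE entry-decay binder; leaf-06 GP `ShellMeasureGradientPinnedLocalEnd.norm_sub_pin_tail₂_locGrad_le`).
Here, as leaf-08's CfP did for the quadratic slot of the other route: LOCALITY + the FLAT printed-TYPE pair suffice.
* §1 **`norm_conj_sub_le_of_local`** (generic; the Lipschitz sibling of CfP `norm_conj_le_sq_of_local`, the field-valued
  sibling of S69 (B) `norm_sub_le_of_blind_lipschitz`): `C : (Λ → 𝔄) → (Λ′ → 𝔅)` with located supports `N c`, reach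
  `N c b → ϖ′ c − r₀ ≤ ϖ b`, `δ′ ≥ 0`, FLAT Lipschitz constant `L` on the flat ball `‖·‖ < R` ⟹ for flat-small `A, A′`:
  `‖Cpin A − Cpin A′‖_pin ≤ L·e^{δ′r₀}·‖A − A′‖_pin` (mix `A′` into `A` on `N c` — the mixture stays in the flat
  sup-ball —, locality, S69 `norm_trunc_le`; the weights `e^{δ′ϖ′c}·e^{−δ′ϖ′c}` cancel: exponent `δ′r₀`, no sign on `ϖ′`).
* §2 **`lipschitz_of_quadPair`** (generic normed spaces): the flat pair `‖C Z‖ ≤ C₂‖Z‖²` + `DifferentiableOn ℂ C (ball 0 R)`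
  ⟹ `‖C Z − C Z′‖ ≤ 2C₂R·‖Z − Z′‖` on `ball 0 (R∕2)` (Cauchy's estimate `B8SectDSource.norm_fderiv_le_of_norm_le` with
  `M = C₂R²` + the mean-value inequality on the convex ball); **`hCp_of_local`** := §1 ∘ §2 — LITERALLY `hCp` at the readings
  `π𝒴′ := (toPiL (pinW δ′ ϖ) 1).symm`, `π𝒳 := (toPiL (pinW δ′ ϖ′) 1).symm`, flat ball `R∕2`, `L_C = 2C₂R·e^{δ′r₀}`.
* §3 **`landauCf_pinnedLipschitz`** — `hCp` for the TREE's (Cf), row S64's `landauCf L U₀ k S S′` ([B7] (134) `C_k(U₀,·)` in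
  the A-currency), on the flat ball `landauRad d L∕2`, `L_C = 2·C2cov d·landauRad d L·e^{δ′r₀}`, from S64
  `landauCorrection_binders` (flat pair, k-uniform) + S68 (b) `landauCf_congr` (locality) + CfP's displayed reach — k-UNIFORM,
  VOLUME-FREE, NO decay display, NO derivative.
* §4 **`hGWp_of_pinnedLipschitz`** (abstract readings): a pinned operator bound of `𝒢` (`‖π𝒴 (𝒢 f)‖ ≤ B_𝒢p‖π𝒵 f‖`, S69 (A)
  shape) × a pinned Lipschitz constant `L_W` of `W` on the flat ball (GP's output shape) ⟹ `hGWp` with `q_W = B_𝒢p·L_W`.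
* §5 **`norm_sub_landauField_chart_le_of_local`** — THE JUNCTION: S70 (iv) `norm_sub_landauField_chart_le` FIRED with
  `hCp` := §2 and `hGWp` := §4 (`𝒴′ := Λ → 𝔄`, `𝒳 := Λ′ → 𝔅` flat, `𝒴`, `𝒵`, `ℬ` abstract; Sect. C's flat list at radius
  `R∕2` derived from the pair at radius `R`, so `hRC` reads `6(ε₄ + B₀b) ≤ R`):
  **`z_pin = B₁ₚbₚ∕((1 − B_𝒢p·L_W)(1 − 2C₂R·e^{δ′r₀}·c_ι·B_H))`** — every symbol a flat scheme constant, a pinned OPERATOR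
  bound of a LINEAR letter, GP's located (P4) Lipschitz constant, or geometry (`r₀`, `δ′`).
η-BOOKKEEPING (N-ne7cp1-g31-3).  `C₂ = C2cov d` and `landauRad d L` are η-free in the A-currency (WALL v2.1 §2b row `Cf V`,
CfP header); `r₀` is in the PIN's units (coarse units: `r₀ < 2`, CfP §2b); `B_𝒢p = c₀·M` carries η only through the
product `c₀·M` (N-3); `L_W` is GP's `m·s·(64M₀∕R³)·e^{δ′r₀}·ρ`.
DISPLAYED, NOT DISCHARGED (c2): the linear letters' kernels ((3.133)∕(46)∕(103) decay — S69 (A) at the dictionary), the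
(P4) letter's pinned Lipschitz constant at the live levels (GP is its one-grid face), W-c [dict]; nothing of Bałaban's at a
live level is discharged; NOTHING in the countdown moves; NE7c NOT PROVED; spine PROVED 0∕9.  HONEST DEPENDENCY (cell):
continuum YM on T⁴ ⇐ BetaPertH ∧ nine spine estimates (0/9 proved); BetaPertH ⇐ (D1) ∧ (D4) ∧ CAP+tail; G-an2-4 gates
asym, D1 and NE2/3/4.
-/

noncomputable section

open Set Metric

namespace Summit.QuantumFields.BalabanUV.T4Continuum.ShellMeasureLandauPinnedLipschitz

open Literature.MathematicalPhysics.QuantumFieldTheory.Balaban1983to89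
open B11Prop6Scheme (Prop4Hyp)
open B8SectDSource (norm_fderiv_le_of_norm_le)
open Summit.QuantumFields.BalabanUV.T4Continuum.ShellMeasureMultiGridNorms (WSup)
open Summit.QuantumFields.BalabanUV.T4Continuum.ShellMeasureMultiGridNorms.WSup (toPiL toPiL_apply toPiL_symm_apply
  norm_le_iff)
open Summit.QuantumFields.BalabanUV.T4Continuum.ShellMeasurePinnedNorm (pinW pinW_apply norm_trunc_le)
open Summit.QuantumFields.BalabanUV.T4Continuum.ShellMeasureLandauHolonomy (solAt landauExp)
open Summit.QuantumFields.BalabanUV.T4Continuum.ShellMeasureLandauPinnedField (norm_sub_landauField_chart_le)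

/-! ## §1 A local flat-Lipschitz letter is pinned-Lipschitz on the flat ball -/

section Local

variable {Λ Λ' : Type*} [Fintype Λ] [Fintype Λ'] {𝔄 𝔅 : Type*} [NormedAddCommGroup 𝔄] [NormedSpace ℂ 𝔄]
  [NormedAddCommGroup 𝔅] [NormedSpace ℂ 𝔅]

/-- **A LOCAL FLAT-LIPSCHITZ LETTER IS PINNED-LIPSCHITZ ON THE FLAT BALL — `hCp` IN THE PINNED CURRENCY, VOLUME-FREE.**
Data: `C : (Λ → 𝔄) → (Λ′ → 𝔅)` with LOCATED SUPPORTS `N c` (`C A c = C A′ c` whenever `A = A′` on `N c`); pins `ϖ` on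
`Λ`, `ϖ′` on `Λ′`, `δ′ ≥ 0`, the one-sided REACH `ϖ′ c − r₀ ≤ ϖ b` for `b ∈ N c`; a FLAT Lipschitz constant `L ≥ 0` on the
flat ball, `‖Z‖, ‖Z′‖ < R → ‖C Z − C Z′‖ ≤ L‖Z − Z′‖`.  CONCLUSION, for FLAT-small `‖A‖, ‖A′‖ < R` read through S69's
pinned spaces: `‖Cpin A − Cpin A′‖_pin ≤ L·e^{δ′r₀}·‖A − A′‖_pin` — LITERALLY the shape of `ShellMeasureLandauPinnedField`'s
binder `hCp` at `π𝒴′ := (toPiL (pinW δ′ ϖ) 1).symm`, `π𝒳 := (toPiL (pinW δ′ ϖ′) 1).symm`.  Proof, per output component `c`: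
mix `A′` into `A` on `N c` (the mixture stays in the flat sup-ball), locality, S69 `norm_trunc_le`; the weights cancel.
No sign on `ϖ`, `ϖ′` is needed. [folklore] -/
theorem norm_conj_sub_le_of_local {δ' : ℝ} (hδ' : 0 ≤ δ') (ϖ : Λ → ℝ) (ϖ' : Λ' → ℝ)
    {C : (Λ → 𝔄) → (Λ' → 𝔅)} (N : Λ' → Λ → Prop)
    (hloc : ∀ A A' : Λ → 𝔄, ∀ c, (∀ b, N c b → A b = A' b) → C A c = C A' c)
    {r₀ : ℝ} (hreach : ∀ c b, N c b → ϖ' c - r₀ ≤ ϖ b)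
    {L R : ℝ} (hL : 0 ≤ L)
    (hCL : ∀ Z Z' : Λ → 𝔄, ‖Z‖ < R → ‖Z'‖ < R → ‖C Z - C Z'‖ ≤ L * ‖Z - Z'‖)
    {A A' : Λ → 𝔄} (hA : ‖A‖ < R) (hA' : ‖A'‖ < R) :
    ‖((toPiL (pinW δ' ϖ') 1).symm (C A) - (toPiL (pinW δ' ϖ') 1).symm (C A') : WSup (pinW δ' ϖ') 1 𝔅)‖ ≤
      L * Real.exp (δ' * r₀) *
        ‖((toPiL (pinW δ' ϖ) 1).symm A - (toPiL (pinW δ' ϖ) 1).symm A' : WSup (pinW δ' ϖ) 1 𝔄)‖ := by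
  classical
  set Y : WSup (pinW δ' ϖ) 1 𝔄 := (toPiL (pinW δ' ϖ) 1).symm A - (toPiL (pinW δ' ϖ) 1).symm A' with hY
  refine (norm_le_iff (pinW δ' ϖ') 1 (by positivity)).2 fun c => ?_
  rw [pow_one, pinW_apply]
  have hcomp : ((toPiL (pinW δ' ϖ') 1).symm (C A) - (toPiL (pinW δ' ϖ') 1).symm (C A') :
      WSup (pinW δ' ϖ') 1 𝔅) c = C A c - C A' c := rfl
  rw [hcomp]
  -- the mixture: `A′` on the located support of `c`, `A` elsewhere
  set s : Finset Λ := Finset.univ.filter (N c) with hs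
  set M : Λ → 𝔄 := fun b => if b ∈ s then A' b else A b with hM
  have hCM : C A' c = C M c := hloc A' M c fun b hb => by
    have hbs : b ∈ s := by rw [hs, Finset.mem_filter]; exact ⟨Finset.mem_univ b, hb⟩
    rw [hM]; dsimp only; rw [if_pos hbs]
  have hR0 : 0 < R := (norm_nonneg A).trans_lt hA
  have hMR : ‖M‖ < R := by
    refine (pi_norm_lt_iff hR0).2 fun b => ?_
    by_cases hb : b ∈ s
    · rw [hM]; dsimp only; rw [if_pos hb]; exact (norm_le_pi_norm A' b).trans_lt hA'
    · rw [hM]; dsimp only; rw [if_neg hb]; exact (norm_le_pi_norm A b).trans_lt hA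
  -- `A − M` is the truncation of `A − A′` to the support
  have hAM : A - M = fun b => if b ∈ s then Y b else (0 : 𝔄) := by
    funext b
    by_cases hb : b ∈ s
    · rw [Pi.sub_apply, hM]; dsimp only; rw [if_pos hb, if_pos hb]; rfl
    · rw [Pi.sub_apply, hM]; dsimp only; rw [if_neg hb, if_neg hb, sub_self]
  have htrunc : ‖A - M‖ ≤ Real.exp (-(δ' * (ϖ' c - r₀))) * ‖Y‖ := by
    rw [hAM]
    exact norm_trunc_le s hδ' ϖ (fun b hb => hreach c b (by rw [hs, Finset.mem_filter] at hb; exact hb.2)) Y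
  have h1 : ‖C A c - C A' c‖ ≤ L * ‖A - M‖ := by
    rw [hCM]
    calc ‖C A c - C M c‖ = ‖(C A - C M) c‖ := rfl
      _ ≤ ‖C A - C M‖ := norm_le_pi_norm _ c
      _ ≤ L * ‖A - M‖ := hCL A M hA hMR
  have hexp : Real.exp (δ' * ϖ' c) * Real.exp (-(δ' * (ϖ' c - r₀))) = Real.exp (δ' * r₀) := by
    rw [← Real.exp_add]; congr 1; ring
  calc Real.exp (δ' * ϖ' c) * ‖C A c - C A' c‖
      ≤ Real.exp (δ' * ϖ' c) * (L * (Real.exp (-(δ' * (ϖ' c - r₀))) * ‖Y‖)) :=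
        mul_le_mul_of_nonneg_left (h1.trans (mul_le_mul_of_nonneg_left htrunc hL)) (Real.exp_nonneg _)
    _ = L * (Real.exp (δ' * ϖ' c) * Real.exp (-(δ' * (ϖ' c - r₀)))) * ‖Y‖ := by ring
    _ = L * Real.exp (δ' * r₀) * ‖Y‖ := by rw [hexp]

end Local

/-! ## §2 The flat (44)-pair gives a flat Lipschitz constant on the half ball (Cauchy) -/

section Cauchy

variable {E F : Type*} [NormedAddCommGroup E] [NormedSpace ℂ E] [NormedAddCommGroup F] [NormedSpace ℂ F]

/-- **THE FLAT (44)-PAIR ⟹ A FLAT LIPSCHITZ CONSTANT ON THE HALF BALL.**  `‖C Z‖ ≤ C₂‖Z‖²` on `‖Z‖ < R` (`0 ≤ C₂`) and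
`DifferentiableOn ℂ C (ball 0 R)` ⟹ `‖C Z − C Z′‖ ≤ 2C₂R·‖Z − Z′‖` for `‖Z‖, ‖Z′‖ < R∕2`: Cauchy's estimate
(`B8SectDSource.norm_fderiv_le_of_norm_le` with `M = C₂R²`: `‖DC(x)‖ ≤ C₂R²∕(R − ‖x‖) ≤ 2C₂R` on the half ball) and the
mean-value inequality on the convex half ball.  (The sharper `4C₂ρ` on `ball 0 ρ`, `2ρ ≤ R`, is B11 (120)'s form —
`B11Prop6Scheme.lipschitz_120`; the half-ball constant is what the junction below consumes.) [folklore] -/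
theorem lipschitz_of_quadPair {C : E → F} {C₂ R : ℝ} (hC₂ : 0 ≤ C₂)
    (hCq : ∀ Z : E, ‖Z‖ < R → ‖C Z‖ ≤ C₂ * ‖Z‖ ^ 2) (hCd : DifferentiableOn ℂ C (ball 0 R))
    {Z Z' : E} (hZ : ‖Z‖ < R / 2) (hZ' : ‖Z'‖ < R / 2) :
    ‖C Z - C Z'‖ ≤ 2 * C₂ * R * ‖Z - Z'‖ := by
  have hR : 0 < R := by linarith [norm_nonneg Z]
  have hb : ∀ A ∈ ball (0 : E) R, ‖C A‖ ≤ C₂ * R ^ 2 := fun A hA => by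
    have hAR := mem_ball_zero_iff.1 hA
    exact (hCq A hAR).trans (mul_le_mul_of_nonneg_left (pow_le_pow_left₀ (norm_nonneg A) hAR.le 2) hC₂)
  have hsub : ball (0 : E) (R / 2) ⊆ ball 0 R := ball_subset_ball (by linarith)
  have hD : ∀ A ∈ ball (0 : E) (R / 2), ‖fderiv ℂ C A‖ ≤ 2 * C₂ * R := fun A hA => by
    have hAn : ‖A‖ < R / 2 := mem_ball_zero_iff.1 hA
    refine (norm_fderiv_le_of_norm_le hCd hb (hAn.trans (by linarith))).trans ?_
    rw [div_le_iff₀ (by linarith)]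
    have h2 : R / 2 ≤ R - ‖A‖ := by linarith
    calc C₂ * R ^ 2 = 2 * C₂ * R * (R / 2) := by ring
      _ ≤ 2 * C₂ * R * (R - ‖A‖) := mul_le_mul_of_nonneg_left h2 (by positivity)
  have hf : ∀ A ∈ ball (0 : E) (R / 2), HasFDerivWithinAt C (fderiv ℂ C A) (ball 0 (R / 2)) A := fun A hA =>
    ((hCd.mono hsub).differentiableAt (isOpen_ball.mem_nhds hA)).hasFDerivAt.hasFDerivWithinAt
  exact (convex_ball (0 : E) (R / 2)).norm_image_sub_le_of_norm_hasFDerivWithin_le hf hD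
    (mem_ball_zero_iff.2 hZ') (mem_ball_zero_iff.2 hZ)

end Cauchy

section LocalPair

variable {Λ Λ' : Type*} [Fintype Λ] [Fintype Λ'] {𝔄 𝔅 : Type*} [NormedAddCommGroup 𝔄] [NormedSpace ℂ 𝔄]
  [NormedAddCommGroup 𝔅] [NormedSpace ℂ 𝔅]

/-- **`hCp` FROM LOCALITY AND THE FLAT (44)-PAIR** (§1 ∘ §2): a local letter `C : (Λ → 𝔄) → (Λ′ → 𝔅)` (located supports
`N`, reach `r₀` against the pins `ϖ`, `ϖ′`, `δ′ ≥ 0`) with the flat pair `‖C Z‖ ≤ C₂‖Z‖²` ∕ `DifferentiableOn` on `ball 0 R`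
(`0 ≤ C₂`, `0 < R`) satisfies, for all flat `‖A‖, ‖A′‖ < R∕2`,
`‖Cpin A − Cpin A′‖_pin ≤ (2C₂R·e^{δ′r₀})·‖A − A′‖_pin` — `ShellMeasureLandauPinnedField`'s `hCp` on the flat ball `R∕2`
with `L_C = 2C₂R·e^{δ′r₀}`, NO decay display, NO derivative. [folklore] -/
theorem hCp_of_local {δ' : ℝ} (hδ' : 0 ≤ δ') (ϖ : Λ → ℝ) (ϖ' : Λ' → ℝ)
    {C : (Λ → 𝔄) → (Λ' → 𝔅)} (N : Λ' → Λ → Prop)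
    (hloc : ∀ A A' : Λ → 𝔄, ∀ c, (∀ b, N c b → A b = A' b) → C A c = C A' c)
    {r₀ : ℝ} (hreach : ∀ c b, N c b → ϖ' c - r₀ ≤ ϖ b)
    {C₂ R : ℝ} (hC₂ : 0 ≤ C₂) (hR : 0 < R) (hCq : ∀ Z : Λ → 𝔄, ‖Z‖ < R → ‖C Z‖ ≤ C₂ * ‖Z‖ ^ 2)
    (hCd : DifferentiableOn ℂ C (ball 0 R)) :
    ∀ A A' : Λ → 𝔄, ‖A‖ < R / 2 → ‖A'‖ < R / 2 →
      ‖((toPiL (pinW δ' ϖ') 1).symm (C A) - (toPiL (pinW δ' ϖ') 1).symm (C A') : WSup (pinW δ' ϖ') 1 𝔅)‖ ≤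
        2 * C₂ * R * Real.exp (δ' * r₀) *
          ‖((toPiL (pinW δ' ϖ) 1).symm A - (toPiL (pinW δ' ϖ) 1).symm A' : WSup (pinW δ' ϖ) 1 𝔄)‖ :=
  fun _ _ hA hA' => norm_conj_sub_le_of_local hδ' ϖ ϖ' N hloc hreach (by positivity)
    (fun _ _ hZ hZ' => lipschitz_of_quadPair hC₂ hCq hCd hZ hZ') hA hA'

end LocalPair

/-! ## §3 The tree's (Cf): row S64's `landauCf`, block-local by S68 (b) -/

section B7

open B7Prop1Local (loK bondHiK)
open B7Prop2Explicit (AvgClosed pdev C0 c2')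
open B7Prop5Flat (BondIn)
open ShellMeasureAverageProp4General (O1cov C2cov)
open ShellMeasureLandauCorrectionB7 (landauCf landauRad landauRad_pos landauCorrection_binders)
open ShellMeasureAverageLocality148 (landauCf_congr)
open ShellMeasureLandauCfPinned (C2cov_nonneg)

variable {d : ℕ} {𝔸 : Type*} [NormedRing 𝔸] [NormedAlgebra ℂ 𝔸] [CompleteSpace 𝔸] [NormOneClass 𝔸]

variable (L : ℕ) (hL : 2 ≤ L) {G : Subgroup 𝔸ˣ} (hG : AvgClosed d L G) (k : ℕ)
  (U₀ : B7Prop1Explicit.Site d → Fin d → 𝔸ˣ) (hU₀ : ∀ x κ, U₀ x κ ∈ G) {α₀ : ℝ} (hα : 0 < α₀)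
  (hα3 : C0 d * α₀ ≤ 1 / 3) (hα4 : 4 * α₀ ≤ c2' d L) (hα6 : 4 * O1cov d * α₀ ≤ 1 / 3)
  (h52 : pdev U₀ < α₀ * (((L : ℝ) ^ k)⁻¹) ^ 2) (S S' : Finset (B7Prop1Explicit.Site d × Fin d))

include hL hG hU₀ hα hα3 hα4 hα6 h52 in
/-- **THE (Cf) LETTER OF THE TREE IS PINNED-LIPSCHITZ ON THE FLAT HALF BALL — `hCp`, k-UNIFORM, VOLUME-FREE.**  Row S64's
`Cf := landauCf L U₀ k S S′ : 𝔸^S → 𝔸^{S′}` read between the pinned spaces `WSup (pinW δ′ ϖ) 1 𝔸` (variables on `S`) and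
`WSup (pinW δ′ ϖ′) 1 𝔸` (`Lᵏ`-bonds of `S′`), `δ′ ≥ 0`, under CfP's DISPLAYED reach of the pins against the box
`B^k(c₋) ∪ B^k(c₊)` (`BondIn (loK L k c) (bondHiK L k c) s → ϖ′ c − r₀ ≤ ϖ s`): for all flat `‖A‖, ‖A′‖ < landauRad d L∕2`,
`‖Cf_pin A − Cf_pin A′‖_pin ≤ (2·C2cov d·landauRad d L·e^{δ′r₀})·‖A − A′‖_pin` — S64 `landauCorrection_binders` (flat pair)
+ S68 (b) `landauCf_congr` (locality) through §2 `hCp_of_local`.  Prop. 2's hypotheses on `U₀` as in S64; `C2cov d`,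
`landauRad d L` see neither `k`, `U₀`, `S`, `S′` nor the volume.  W-c [dict] untouched. [folklore] -/
theorem landauCf_pinnedLipschitz {δ' r₀ : ℝ} (hδ' : 0 ≤ δ') (ϖ : ↥S → ℝ) (ϖ' : ↥S' → ℝ)
    (hreach : ∀ (c : ↥S') (s : ↥S), BondIn (loK L k c.1.1) (bondHiK L k c.1.1 c.1.2) s.1.1 s.1.2 → ϖ' c - r₀ ≤ ϖ s) :
    ∀ A A' : ↥S → 𝔸, ‖A‖ < landauRad d L / 2 → ‖A'‖ < landauRad d L / 2 →
      ‖((toPiL (pinW δ' ϖ') 1).symm (landauCf L U₀ k S S' A) -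
          (toPiL (pinW δ' ϖ') 1).symm (landauCf L U₀ k S S' A') : WSup (pinW δ' ϖ') 1 𝔸)‖ ≤
        2 * C2cov d * landauRad d L * Real.exp (δ' * r₀) *
          ‖((toPiL (pinW δ' ϖ) 1).symm A - (toPiL (pinW δ' ϖ) 1).symm A' : WSup (pinW δ' ϖ) 1 𝔸)‖ :=
  hCp_of_local hδ' ϖ ϖ' (fun (c : ↥S') (s : ↥S) => BondIn (loK L k c.1.1) (bondHiK L k c.1.1 c.1.2) s.1.1 s.1.2)
    (fun _ _ c h => landauCf_congr (le_trans (by norm_num) hL) U₀ k S S' c h) hreach (C2cov_nonneg d)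
    (landauRad_pos d (le_trans (by norm_num) hL))
    (landauCorrection_binders L hL hG k U₀ hU₀ hα hα3 hα4 hα6 h52 S S').1
    (landauCorrection_binders L hL hG k U₀ hU₀ hα hα3 hα4 hα6 h52 S S').2

end B7

/-! ## §4 The `W`-slot: pinned operator bound of `𝒢` × pinned Lipschitz constant of `W` -/

section GW

variable {𝒴 𝒵 P𝒴 P𝒵 : Type*} [NormedAddCommGroup 𝒴] [NormedSpace ℂ 𝒴] [NormedAddCommGroup 𝒵] [NormedSpace ℂ 𝒵]
  [NormedAddCommGroup P𝒴] [NormedSpace ℂ P𝒴] [NormedAddCommGroup P𝒵] [NormedSpace ℂ P𝒵]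

/-- **`hGWp` FROM A PINNED OPERATOR BOUND OF `𝒢` AND A PINNED LIPSCHITZ CONSTANT OF `W`.**  Readings `π𝒴`, `π𝒵`;
`‖π𝒴 (𝒢 f)‖ ≤ B_𝒢p·‖π𝒵 f‖` (`0 ≤ B_𝒢p`; S69 (A) `opNorm_kerOpPin_le`'s output shape for the (P2) propagator, (3.133)
decay-halves TYPE) and `‖π𝒵 (W Y) − π𝒵 (W Y′)‖ ≤ L_W·‖π𝒴 Y − π𝒴 Y′‖` on the flat ball `‖·‖ < ε` (GP
`ShellMeasureGradientPinnedLocalEnd.norm_sub_pin_tail₂_locGrad_le`'s output shape, `ρ := ε ≤ R∕4`) ⟹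
`ShellMeasureLandauPinnedField`'s `hGWp` with `q_W = B_𝒢p·L_W`. [folklore] -/
theorem hGWp_of_pinnedLipschitz (π𝒴 : 𝒴 →L[ℂ] P𝒴) (π𝒵 : 𝒵 →L[ℂ] P𝒵) {𝒢 : 𝒵 →L[ℂ] 𝒴} {W : 𝒴 → 𝒵}
    {B𝒢p LW ε : ℝ} (hB𝒢p : 0 ≤ B𝒢p) (h𝒢p : ∀ f, ‖π𝒴 (𝒢 f)‖ ≤ B𝒢p * ‖π𝒵 f‖)
    (hWp : ∀ Y Y', ‖Y‖ < ε → ‖Y'‖ < ε → ‖π𝒵 (W Y) - π𝒵 (W Y')‖ ≤ LW * ‖π𝒴 Y - π𝒴 Y'‖) :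
    ∀ Y Y', ‖Y‖ < ε → ‖Y'‖ < ε → ‖π𝒴 (𝒢 (W Y)) - π𝒴 (𝒢 (W Y'))‖ ≤ B𝒢p * LW * ‖π𝒴 Y - π𝒴 Y'‖ := by
  intro Y Y' hY hY'
  calc ‖π𝒴 (𝒢 (W Y)) - π𝒴 (𝒢 (W Y'))‖ = ‖π𝒴 (𝒢 (W Y - W Y'))‖ := by rw [map_sub, map_sub]
    _ ≤ B𝒢p * ‖π𝒵 (W Y - W Y')‖ := h𝒢p _
    _ = B𝒢p * ‖π𝒵 (W Y) - π𝒵 (W Y')‖ := by rw [map_sub]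
    _ ≤ B𝒢p * (LW * ‖π𝒴 Y - π𝒴 Y'‖) := mul_le_mul_of_nonneg_left (hWp Y Y' hY hY') hB𝒢p
    _ = B𝒢p * LW * ‖π𝒴 Y - π𝒴 Y'‖ := by ring

end GW

/-! ## §5 The junction: S70 (iv) with `hCp` and `hGWp` inhabited -/

section Junction

variable {Λ Λ' : Type*} [Fintype Λ] [Fintype Λ'] {𝔄 𝔅 : Type*} [NormedAddCommGroup 𝔄] [NormedSpace ℂ 𝔄]
  [NormedAddCommGroup 𝔅] [NormedSpace ℂ 𝔅] [CompleteSpace 𝔅]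
variable {𝒴 𝒵 ℬ P𝒴 P𝒵 Pℬ : Type*} [NormedAddCommGroup 𝒴] [NormedSpace ℂ 𝒴] [CompleteSpace 𝒴]
  [NormedAddCommGroup 𝒵] [NormedSpace ℂ 𝒵] [NormedAddCommGroup ℬ] [NormedSpace ℂ ℬ]
  [NormedAddCommGroup P𝒴] [NormedSpace ℂ P𝒴] [NormedAddCommGroup P𝒵] [NormedSpace ℂ P𝒵]
  [NormedAddCommGroup Pℬ] [NormedSpace ℂ Pℬ]

/-- **S70 (iv) WITH THE NONLINEAR PINNED BINDERS INHABITED BY LOCALITY.**  The LD chain with `𝒴′ := Λ → 𝔄` and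
`𝒳 := Λ′ → 𝔅` FLAT (sup norms; `𝒴`, `𝒵`, `ℬ` abstract), readings `π𝒴`, `π𝒵`, `πℬ` abstract and
`π𝒴′ := (toPiL (pinW δ′ ϖ) 1).symm`, `π𝒳 := (toPiL (pinW δ′ ϖ′) 1).symm` (S69's pinned spaces).  FLAT binders VERBATIM from
`ShellMeasureLandauPinnedField.norm_sub_landauField_chart_le` ((P2) `h𝒢`, (P4) `hW`, (118)∕(121) at `a = B₀b`, (103) `hH₁`,
(75)-TYPE `hΦ` with `Φ 0 = 0`, (44) `hCq`∕`hCd` at radius `R`, scaling `hι`, (46) `hH`, (54) `hq`) except that Sect. C is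
run at radius `R∕2`: **`hRC : 6(ε₄ + B₀b) ≤ R`**.  In place of `hCp`: the (44) letter's LOCATED SUPPORTS `N` with reach `r₀`
(§2 `hCp_of_local`).  In place of `hGWp`: a pinned operator bound `B_𝒢p` of `𝒢` and a pinned Lipschitz constant `L_W` of `W`
on the flat ball `ε₄ + B₀b` (§4), `B_𝒢p·L_W < 1`.  Remaining pinned binders as there: `hιp`, `hHp` (with
`k = 2C₂R·e^{δ′r₀}·c_ι·B_H < 1`), `hH₁p`, `hΦp`.  CONCLUSION, for the exponent field
`Z_V z = landauExp C ι H (4C₂(ε₄+B₀b)²) (solAt 𝒢 0 W ε₄ 0 (H₁ (Φ z)) + H₁ (Φ z))` and every `z` in the chart ball: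
`‖π𝒴 (Z_V z) − π𝒴 (Z_V 0)‖ ≤ z_pin` and `‖π𝒴 (Z_V z)‖ ≤ z_pin`,
**`z_pin = B₁ₚbₚ∕((1 − B_𝒢p·L_W)(1 − 2C₂R·e^{δ′r₀}·c_ι·B_H))`**.  Nothing printed is asserted; no estimate of Bałaban's
discharged; NE7c NOT PROVED. [folklore] -/
theorem norm_sub_landauField_chart_le_of_local {m₀ : ℕ} (π𝒴 : 𝒴 →L[ℂ] P𝒴) (π𝒵 : 𝒵 →L[ℂ] P𝒵) (πℬ : ℬ →L[ℂ] Pℬ)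
    {δ' : ℝ} (hδ' : 0 ≤ δ') (ϖ : Λ → ℝ) (ϖ' : Λ' → ℝ)
    {𝒢 : 𝒵 →L[ℂ] 𝒴} {W : 𝒴 → 𝒵} {B₀ C₄ a₃ ε₄ b : ℝ}
    {C : (Λ → 𝔄) → (Λ' → 𝔅)} {ι : 𝒴 →L[ℂ] (Λ → 𝔄)} {H : (Λ' → 𝔅) →L[ℂ] 𝒴} {C₂ R cι BH : ℝ}
    {H₁ : ℬ →L[ℂ] 𝒴} {Φ : (Fin m₀ → ℂ) → ℬ} {rΦ B₁p bp B𝒢p LW : ℝ}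
    -- the flat lists
    (h𝒢 : ∀ f, ‖𝒢 f‖ ≤ B₀ * ‖f‖) (hW : Prop4Hyp W C₄ a₃) (hB₀ : 0 < B₀) (hC₄ : 0 ≤ C₄) (hε₄ : 0 ≤ ε₄)
    (hdom : 2 * (ε₄ + B₀ * b) ≤ a₃) (hself : B₀ * C₄ * (ε₄ + B₀ * b) ^ 2 ≤ ε₄)
    (hcontr : 4 * B₀ * C₄ * (ε₄ + B₀ * b) < 1)
    (hH₁ : ∀ B, ‖H₁ B‖ ≤ B₀ * ‖B‖) (hΦ0 : Φ 0 = 0) (hΦ : ∀ z ∈ ball (0 : Fin m₀ → ℂ) rΦ, ‖Φ z‖ < b)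
    (hC₂ : 0 ≤ C₂) (hCq : ∀ Z : Λ → 𝔄, ‖Z‖ < R → ‖C Z‖ ≤ C₂ * ‖Z‖ ^ 2) (hCd : DifferentiableOn ℂ C (ball 0 R))
    (hι : ∀ Y, ‖ι Y‖ ≤ ‖Y‖) (hH : ∀ X, ‖H X‖ ≤ B₀ * ‖X‖) (hq : 9 * C₂ * B₀ * (ε₄ + B₀ * b) < 1)
    (hRC : 6 * (ε₄ + B₀ * b) ≤ R)
    -- the (44) letter's locality and the reach of the pins (in place of `hCp`)
    (N : Λ' → Λ → Prop) (hloc : ∀ A A' : Λ → 𝔄, ∀ c, (∀ b', N c b' → A b' = A' b') → C A c = C A' c)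
    {r₀ : ℝ} (hreach : ∀ c b', N c b' → ϖ' c - r₀ ≤ ϖ b')
    -- the `W`-slot (in place of `hGWp`)
    (hB𝒢p : 0 ≤ B𝒢p) (h𝒢p : ∀ f, ‖π𝒴 (𝒢 f)‖ ≤ B𝒢p * ‖π𝒵 f‖)
    (hWp : ∀ Y Y', ‖Y‖ < ε₄ + B₀ * b → ‖Y'‖ < ε₄ + B₀ * b → ‖π𝒵 (W Y) - π𝒵 (W Y')‖ ≤ LW * ‖π𝒴 Y - π𝒴 Y'‖)
    (hqW : B𝒢p * LW < 1)
    -- the remaining pinned binders (linear letters; the block-supported coarse field)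
    (hιp : ∀ Y, ‖((toPiL (pinW δ' ϖ) 1).symm (ι Y) : WSup (pinW δ' ϖ) 1 𝔄)‖ ≤ cι * ‖π𝒴 Y‖)
    (hHp : ∀ X, ‖π𝒴 (H X)‖ ≤ BH * ‖((toPiL (pinW δ' ϖ') 1).symm X : WSup (pinW δ' ϖ') 1 𝔅)‖)
    (hcι : 0 ≤ cι) (hBH : 0 ≤ BH) (hk : 2 * C₂ * R * Real.exp (δ' * r₀) * cι * BH < 1)
    (hB₁p : 0 ≤ B₁p) (hH₁p : ∀ B, ‖π𝒴 (H₁ B)‖ ≤ B₁p * ‖πℬ B‖)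
    (hΦp : ∀ z ∈ ball (0 : Fin m₀ → ℂ) rΦ, ‖πℬ (Φ z)‖ ≤ bp) {z : Fin m₀ → ℂ} (hz : z ∈ ball (0 : Fin m₀ → ℂ) rΦ) :
    ‖π𝒴 (landauExp C ι H (4 * C₂ * (ε₄ + B₀ * b) ^ 2) (solAt 𝒢 0 W ε₄ (0 : 𝒵) (H₁ (Φ z)) + H₁ (Φ z))) -
        π𝒴 (landauExp C ι H (4 * C₂ * (ε₄ + B₀ * b) ^ 2) (solAt 𝒢 0 W ε₄ (0 : 𝒵) (H₁ (Φ 0)) + H₁ (Φ 0)))‖ ≤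
      B₁p * bp / ((1 - B𝒢p * LW) * (1 - 2 * C₂ * R * Real.exp (δ' * r₀) * cι * BH)) ∧
    ‖π𝒴 (landauExp C ι H (4 * C₂ * (ε₄ + B₀ * b) ^ 2) (solAt 𝒢 0 W ε₄ (0 : 𝒵) (H₁ (Φ z)) + H₁ (Φ z)))‖ ≤
      B₁p * bp / ((1 - B𝒢p * LW) * (1 - 2 * C₂ * R * Real.exp (δ' * r₀) * cι * BH)) := by
  have hε : 0 < ε₄ + B₀ * b := by
    have hrΦ : 0 < rΦ := (norm_nonneg z).trans_lt (mem_ball_zero_iff.1 hz)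
    have hb : 0 < b := by have h := hΦ 0 (mem_ball_self hrΦ); rwa [hΦ0, norm_zero] at h
    exact add_pos_of_nonneg_of_pos hε₄ (mul_pos hB₀ hb)
  have hR : 0 < R := by linarith
  -- Sect. C's flat list at radius `R∕2`
  have hCq' : ∀ Z : Λ → 𝔄, ‖Z‖ < R / 2 → ‖C Z‖ ≤ C₂ * ‖Z‖ ^ 2 := fun Z hZ => hCq Z (hZ.trans (by linarith))
  have hCd' : DifferentiableOn ℂ C (ball 0 (R / 2)) := hCd.mono (ball_subset_ball (by linarith))
  have hRC' : 3 * (ε₄ + B₀ * b) ≤ R / 2 := by linarith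
  -- the two inhabited binders, read through the readings as continuous linear maps
  have hCp := hCp_of_local hδ' ϖ ϖ' N hloc hreach hC₂ hR hCq hCd
  have hGWp := hGWp_of_pinnedLipschitz π𝒴 π𝒵 hB𝒢p h𝒢p hWp
  refine norm_sub_landauField_chart_le π𝒴 (toPiL (𝔄 := 𝔄) (pinW δ' ϖ) 1).symm.toContinuousLinearMap
    (toPiL (𝔄 := 𝔅) (pinW δ' ϖ') 1).symm.toContinuousLinearMap πℬ h𝒢 hW hB₀ hC₄ hε₄ hdom hself hcontr
    hH₁ hΦ0 hΦ hC₂ hCq' hCd' hι hH hq hRC' hGWp hqW (fun A A' hA hA' => ?_) (fun Y => ?_) (fun X => ?_)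
    (by positivity) hcι hBH hk hB₁p hH₁p hΦp hz
  · simpa only [ContinuousLinearEquiv.coe_coe] using hCp A A' hA hA'
  · simpa only [ContinuousLinearEquiv.coe_coe] using hιp Y
  · simpa only [ContinuousLinearEquiv.coe_coe] using hHp X

end Junction

/-! ## §6 Non-vacuity of §§1–2: a local quadratic letter on two sites -/

section Toy

/-- TOY: `Λ = Λ′ = Fin 2`, `𝔄 = 𝔅 = ℂ`, `C A c := (A c)²` (support `N c = {c}`, reach `r₀ = 0` for equal pins), flat pair
`C₂ = 1` on `ball 0 2`: §2 `hCp_of_local` gives the pinned Lipschitz constant `2·1·2·e^{δ′·0}` on the flat ball `1`, for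
every `δ′ ≥ 0` and every pin. [folklore] -/
example (δ' : ℝ) (hδ' : 0 ≤ δ') (ϖ : Fin 2 → ℝ) (A A' : Fin 2 → ℂ) (hA : ‖A‖ < 2 / 2) (hA' : ‖A'‖ < 2 / 2) :
    ‖((toPiL (pinW δ' ϖ) 1).symm ((fun B : Fin 2 → ℂ => fun c => B c ^ 2) A) -
        (toPiL (pinW δ' ϖ) 1).symm ((fun B : Fin 2 → ℂ => fun c => B c ^ 2) A') : WSup (pinW δ' ϖ) 1 ℂ)‖ ≤
      2 * 1 * 2 * Real.exp (δ' * 0) *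
        ‖((toPiL (pinW δ' ϖ) 1).symm A - (toPiL (pinW δ' ϖ) 1).symm A' : WSup (pinW δ' ϖ) 1 ℂ)‖ := by
  refine hCp_of_local (C := fun B : Fin 2 → ℂ => fun c => B c ^ 2) hδ' ϖ ϖ (fun c b => b = c)
    (fun B B' c h => by simp only [h c rfl]) (fun c b hb => by subst hb; linarith) zero_le_one two_pos
    (fun Z _ => ?_) ?_ A A' hA hA'
  · refine (pi_norm_le_iff_of_nonneg (by positivity)).2 fun c => ?_
    rw [norm_pow, one_mul]
    exact pow_le_pow_left₀ (norm_nonneg _) (norm_le_pi_norm Z c) 2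
  · exact (differentiable_pi.2 fun c =>
      ((ContinuousLinearMap.proj c : (Fin 2 → ℂ) →L[ℂ] ℂ).differentiable.pow 2)).differentiableOn

end Toy

end Summit.QuantumFields.BalabanUV.T4Continuum.ShellMeasureLandauPinnedLipschitz

end
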